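import Literature.LinearAlgebra.RootSystem.AffineWeylGroupLengthFormula
import HarnessLib

/-!
# Descents in `W_a`: when `ℓ(σ s) < ℓ(σ)` for `σ = t(d)w` (Iwahori–Matsumoto 1965, Propositions 1.28–1.29; Humphreys 1990 §4.4 (c))

N. Iwahori, H. Matsumoto, *On some Bruhat decomposition and the structure of the Hecke rings of p-adic Chevalley groups*, Publ. Math. IHÉS
25 (1965) [IwahoriMatsumoto1965] (held `paper:doi-10-1007-bf02684396`, PDF p. 20 = journal p. 255), §1.9: «For later use, we give a criterion
for `P_i` to belong to `Λ(σ⁻¹)`, i.e. a criterion for `λ(σw_i) < λ(σ)` (`σ ∈ DW`). **Proposition 1.28.** Let `σ = T(d)w`, `d ∈ P`, `w ∈ W` and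
`i` an integer with `1 ≤ i ≤ l`. Then we have (i) `λ(σw_i) < λ(σ)` if `w(α_i) > 0`, `(w(α_i), d) > 0`, or if `w(α_i) < 0`, `(w(α_i), d) ≥ 0`.
(ii) `λ(σw_i) > λ(σ)` if `w(α_i) > 0`, `(w(α_i), d) ≤ 0`, or if `w(α_i) < 0`, `(w(α_i), d) < 0`. Proof. Let `a ∈ 𝔇∘`. Then `λ(σw_i) < λ(σ)`
is equivalent to `P_i ∈ Λ(σ⁻¹)` … The following proposition is also proved similarly. **Proposition 1.29.** Let `σ = T(d)w`, `d ∈ P`, `w ∈ W`.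
Then we have (i) `λ(σw₀) < λ(σ)` if `w(α₀) > 0`, `0 ≥ (w(α₀), d) + 1`, or if `w(α₀) < 0`, `0 > (w(α₀), d) + 1`. (ii) `λ(σw₀) > λ(σ)` if
`w(α₀) > 0`, `0 < (w(α₀), d) + 1`, or if `w(α₀) < 0`, `0 ≤ (w(α₀), d) + 1`.» Here (§1.4, p. 242) «we denote by `α₁, …, α_l` the
fundamental roots and by `α₀` the highest root. Also we put `P_i = P_{α_i,0}` (`i = 1, …, l`), `P₀ = P_{α₀,1}`, `w_i = w_{α_i}`, `w₀ = w_{α₀,1}`»,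
`D∘ = {x ; 0 < (α_i, x), 1 > (α₀, x)}` (§1.3), `λ(σ)` = the number of hyperplanes `P_{α,k}` separating `D∘` from `σD∘` = the word length
(Proposition 1.10), and «`σ⁻¹(a) = w⁻¹(a - d)`. Hence `(α_i, σ⁻¹(a)) = (w(α_i), a) - (w(α_i), d)`» (proof of 1.28).
J. E. Humphreys, *Reflection Groups and Coxeter Groups* (1990) [Humphreys1990], §4.4 Proposition (c): «`n(ws) = n(w) - 1` if `H_s ∈ 𝓛(w⁻¹)`, and
`n(ws) = n(w) + 1` otherwise.»

THIS FILE (lane `lit-hodgefound`, prover seat p40, generation 45, row g45-#9; THEOREMS ONLY — no definition, instance, notation or named fact;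
net debt 0) specialises row g44-#12's floor-data form of Proposition 4.4 (c) (`sum_abs_data_mul_wall_eq`: `n(σs) = n(σ) ∓ 1` according as
`H_s` separates `A∘` from `σ⁻¹A∘`) to `σ = t(d)·g` (`d ∈ P(Φ)` with levels `m_α = ⟨d, α^∨⟩`, `g ∈ W`), whose inverse `t(-g⁻¹d)·g⁻¹` maps `A∘`
to the alcove with data `α ↦ k∘_{gα} - m_{gα}` (§1): the separation test becomes IM's sign conditions on `gα_j` and `⟨d, (gα_j)^∨⟩`. CONVENTIONS
of the `AffineWeylGroup*` files (weight space `M`, coroot levels, `2n(σ) = Σ_α |k_α - k∘_α|` for `σA∘ = alcove k`, `ℓ = n` on `W_a`, row g45-#1);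
IM's `(w(α), d)` is our `⟨d, (gα)^∨⟩ = m_{gα}`, `w(α) > 0` is `b.IsPos (g • α)`, their `α₀` (the highest root, `P₀ = P_{α₀,1}`) is our `η`
and their `w₀ = w_{α₀,1}` is the new wall `s_{α_η,1} = wallReflection b η none`; `λ = ℓ` on `W_a` by their Proposition 1.10 / row g45-#1.

* §1 ★ `image_inv_constVAdd_mul_affineHom_fundamentalAlcove` (`σ⁻¹A∘ = alcove (α ↦ k∘_{gα} - m_{gα})`).
* §2 ★★★ `sum_abs_data_mul_reflection_eq` — PROPOSITION 1.28 in floor data: for `j ∈ Δ`, `2n(σ s_{α_j}) = 2n(σ) - 2` iff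
  `(gα_j > 0 ∧ m_{gα_j} > 0) ∨ (gα_j < 0 ∧ m_{gα_j} ≥ 0)`, and `+ 2` otherwise; ★★★ `sum_abs_data_mul_affineReflection_one_eq` — PROPOSITION 1.29:
  `2n(σ s_{α_η,1}) = 2n(σ) - 2` iff `(gα_η > 0 ∧ m_{gα_η} ≤ -1) ∨ (gα_η < 0 ∧ m_{gα_η} ≤ -2)`, `+ 2` otherwise.
* §3 the same for p13's word length on `W_a` (`d ∈ Q`): ★★★ `length_mul_wallReflection_some_eq` ∕ `length_mul_wallReflection_none_eq`
  (`ℓ(σ s) = ℓ(σ) - 1` or `ℓ(σ) + 1` by the same tests), and the two classical special cases ★★ `length_affineHom_mul_wallReflection_eq`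
  (`d = 0`: `ℓ(g s_{α_j}) = ℓ(g) - 1 ⟺ gα_j < 0`; `ℓ(g s_{α_η,1}) = ℓ(g) + 1` always — every `g ∈ W` is of minimal length in its coset
  `g⟨s_{α_η,1}⟩`) and ★★ `length_constVAdd_mul_wallReflection_eq` (`g = 1`: `ℓ(t(d) s_{α_j}) = ℓ(t(d)) - 1 ⟺ ⟨d, α_j^∨⟩ > 0`,
  `ℓ(t(d) s_{α_η,1}) = ℓ(t(d)) - 1 ⟺ ⟨d, α_η^∨⟩ ≤ -1`).

BY NAME, nothing restated: rows g44-#12 (`sum_abs_data_mul_wall_eq`), g44-#6 (`alcove`, `fundamentalAlcove_eq_alcove`), g44-#1 (`affineHom`,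
`affineReflection`, `affineReflection_zero`, `mul_constVAdd`, `affineWeylGroup_le_extendedAffineWeylGroup`), g45-#4 (`image_constVAdd_mul_affineHom_fundamentalAlcove`),
g45-#1 (`wallReflection`, `two_mul_length_affineWeylGroup_eq`), `WeylGroupSimpleReflections` (`coroot'_smul_smul`).

## References

* [IwahoriMatsumoto1965] N. Iwahori, H. Matsumoto, Publ. Math. IHÉS 25 (1965) 5–48, §1.4 (p. 242), §1.9 Propositions 1.28 and 1.29 (p. 255).
* [Humphreys1990] J. E. Humphreys, *Reflection Groups and Coxeter Groups*, CUP (1990), §4.4 Proposition (c), §4.5 Theorem (b).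
* [Bourbaki2002LieGroups46] N. Bourbaki, *Lie Groups and Lie Algebras, Chapters 4–6*, Ch. VI §2 (cite-only).
-/

noncomputable section

open Module Set Function
open Literature.GroupTheory.Coxeter Literature.GroupTheory.Coxeter.PreCoxeterSystem

namespace Literature.LinearAlgebra.RootSystem

namespace Base

variable {ι K M N : Type*} [Field K] [LinearOrder K] [IsStrictOrderedRing K] [AddCommGroup M] [Module K M]
  [AddCommGroup N] [Module K N] [Fintype ι] [DecidableEq ι]
  {P : RootPairing ι K M N} [CharZero K] [P.IsCrystallographic] [P.IsReduced] (b : P.Base)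

/-! ## §1 The alcove `σ⁻¹A∘` for `σ = t(d)g` -/

section Inverse

omit [LinearOrder K] [IsStrictOrderedRing K] [Fintype ι] [DecidableEq ι] [CharZero K] [P.IsCrystallographic] [P.IsReduced] in
/-- `(t(d)g)⁻¹ = t(-g⁻¹d) g⁻¹`. [cite: IwahoriMatsumoto1965, §1.9 proof of Proposition 1.28 ("σ⁻¹(a) = w⁻¹(a - d)")] -/
theorem inv_constVAdd_mul_affineHom (d : M) (g : P.Aut) :
    (AffineEquiv.constVAdd K M d * affineHom P g)⁻¹ = AffineEquiv.constVAdd K M (-(g⁻¹ • d)) * affineHom P g⁻¹ := by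
  rw [mul_inv_rev, ← map_inv, AffineEquiv.inv_def, AffineEquiv.constVAdd_symm, mul_constVAdd, linear_affineHom, map_neg]
  rfl

omit [LinearOrder K] [IsStrictOrderedRing K] [Fintype ι] [DecidableEq ι] [CharZero K] [P.IsCrystallographic] [P.IsReduced] in
/-- The levels of `-g⁻¹d` are `α ↦ -⟨d, (gα)^∨⟩`. [cite: IwahoriMatsumoto1965, §1.9 proof of Proposition 1.28 ("(α_i, σ⁻¹(a)) = (w(α_i), a) - (w(α_i), d)")] -/
theorem coroot'_neg_inv_smul {d : M} {m : ι → ℤ} (hm : ∀ i, P.coroot' i d = m i) (g : P.Aut) (i : ι) :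
    P.coroot' i (-(g⁻¹ • d)) = ((-m (g • i) : ℤ) : K) := by
  rw [map_neg, Int.cast_neg, ← hm (g • i), ← coroot'_smul_smul g⁻¹ (g • i) d, inv_smul_smul]

omit [Fintype ι] [DecidableEq ι] [P.IsCrystallographic] [P.IsReduced] in
/-- ★ **`σ⁻¹A∘ = alcove (α ↦ k∘_{gα} - m_{gα})` FOR `σ = t(d)g`.** [cite: IwahoriMatsumoto1965, §1.9 proof of Proposition 1.28] -/
theorem image_inv_constVAdd_mul_affineHom_fundamentalAlcove [DecidablePred b.IsPos] {d : M} {m : ι → ℤ} (hm : ∀ i, P.coroot' i d = m i)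
    (g : P.Aut) :
    ⇑(AffineEquiv.constVAdd K M d * affineHom P g)⁻¹ '' {x : M | ∀ i, b.IsPos i → 0 < P.coroot' i x ∧ P.coroot' i x < 1} =
      alcove P (fun i ↦ (if b.IsPos (g • i) then (0 : ℤ) else -1) + -m (g • i)) := by
  rw [inv_constVAdd_mul_affineHom, image_constVAdd_mul_affineHom_fundamentalAlcove b g⁻¹ (coroot'_neg_inv_smul hm g)]
  simp only [inv_inv]

end Inverse

/-! ## §2 Propositions 1.28 and 1.29 in floor data -/

section FloorData

/-- ★★★ **IWAHORI–MATSUMOTO PROPOSITION 1.28 (in floor data)**: for `σ = t(d)g ∈ Ŵ_a` (`d ∈ P(Φ)` with levels `m`, `g ∈ W`), `σA∘ = alcove k`, and a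
simple reflection `s_{α_j}` (`j ∈ Δ`) with `σ s_{α_j} A∘ = alcove k'`: the separating count DROPS by one hyperplane — `Σ|k' - k∘| = Σ|k - k∘| - 2` —
exactly when `gα_j > 0 ∧ ⟨d, (gα_j)^∨⟩ > 0` or `gα_j < 0 ∧ ⟨d, (gα_j)^∨⟩ ≥ 0`, and otherwise RISES by one (`+ 2`).
[cite: IwahoriMatsumoto1965, §1.9 Proposition 1.28 (i), (ii)] [cite: Humphreys1990, §4.4 Proposition (c)] -/
theorem sum_abs_data_mul_reflection_eq [Nonempty ι] [DecidablePred b.IsPos] {η : ι}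
    (hη : ∀ k, P.coroot η - P.coroot k ∈ AddSubmonoid.closure (P.coroot '' (b.support : Set ι))) {d : M} (hd : d ∈ weightLattice P)
    {m : ι → ℤ} (hm : ∀ i, P.coroot' i d = m i) {g : P.Aut} (hg : g ∈ P.weylGroup) {j : ι} (hj : j ∈ b.support) {k k' : ι → ℤ}
    (hk : (AffineEquiv.constVAdd K M d * affineHom P g) '' {x : M | ∀ i, b.IsPos i → 0 < P.coroot' i x ∧ P.coroot' i x < 1} = alcove P k)
    (hk' : ⇑(AffineEquiv.constVAdd K M d * affineHom P g * affineHom P (RootPairing.Equiv.reflection P j)) ''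
      {x : M | ∀ i, b.IsPos i → 0 < P.coroot' i x ∧ P.coroot' i x < 1} = alcove P k') :
    (((b.IsPos (g • j) ∧ 0 < m (g • j)) ∨ (¬ b.IsPos (g • j) ∧ 0 ≤ m (g • j))) →
      ∑ i, |k' i - (if b.IsPos i then (0 : ℤ) else -1)| = ∑ i, |k i - (if b.IsPos i then (0 : ℤ) else -1)| - 2) ∧
    (¬ ((b.IsPos (g • j) ∧ 0 < m (g • j)) ∨ (¬ b.IsPos (g • j) ∧ 0 ≤ m (g • j))) →
      ∑ i, |k' i - (if b.IsPos i then (0 : ℤ) else -1)| = ∑ i, |k i - (if b.IsPos i then (0 : ℤ) else -1)| + 2) := by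
  have hσ : AffineEquiv.constVAdd K M d * affineHom P g ∈ extendedAffineWeylGroup P :=
    Subgroup.mul_mem _ (constVAdd_mem_extendedAffineWeylGroup P hd) (affineHom_mem_extendedAffineWeylGroup P hg)
  have hk'' : ⇑(AffineEquiv.constVAdd K M d * affineHom P g * affineReflection P j ((0 : ℤ) : K)) ''
      {x : M | ∀ i, b.IsPos i → 0 < P.coroot' i x ∧ P.coroot' i x < 1} = alcove P k' := by
    rw [Int.cast_zero, affineReflection_zero]; exact hk'
  have hq := image_inv_constVAdd_mul_affineHom_fundamentalAlcove b hm g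
  obtain ⟨h1, h2⟩ := sum_abs_data_mul_wall_eq b hη hσ (a := j) (ma := 0) (Or.inl ⟨hj, rfl⟩) hk hk'' hq
  -- the separation test `Xor (0 ≤ k∘_j) (0 ≤ k∘_{gα_j} - m_{gα_j})` is IM's sign condition
  have hjpos : b.IsPos j := b.isPos_of_mem_support hj
  have hiff : Xor ((0 : ℤ) ≤ (if b.IsPos j then (0 : ℤ) else -1)) ((0 : ℤ) ≤ (if b.IsPos (g • j) then (0 : ℤ) else -1) + -m (g • j)) ↔
      ((b.IsPos (g • j) ∧ 0 < m (g • j)) ∨ (¬ b.IsPos (g • j) ∧ 0 ≤ m (g • j))) := by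
    rw [if_pos hjpos]
    by_cases hgj : b.IsPos (g • j)
    · rw [if_pos hgj]; unfold Xor; constructor
      · rintro (⟨-, h⟩ | ⟨h, h'⟩)
        · exact Or.inl ⟨hgj, by omega⟩
        · exact absurd le_rfl h'
      · rintro (⟨-, h⟩ | ⟨h, -⟩)
        · exact Or.inl ⟨le_rfl, by omega⟩
        · exact absurd hgj h
    · rw [if_neg hgj]; unfold Xor; constructor
      · rintro (⟨-, h⟩ | ⟨h, h'⟩)
        · exact Or.inr ⟨hgj, by omega⟩
        · exact absurd le_rfl h'
      · rintro (⟨h, -⟩ | ⟨-, h⟩)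
        · exact absurd h hgj
        · exact Or.inl ⟨le_rfl, by omega⟩
  exact ⟨fun h ↦ h1 (hiff.mpr h), fun h ↦ h2 (fun h' ↦ h (hiff.mp h'))⟩

/-- ★★★ **IWAHORI–MATSUMOTO PROPOSITION 1.29 (in floor data)**: the same for the NEW WALL `s_{α_η,1}`: with `σ s_{α_η,1} A∘ = alcove k'`, the count
drops (`Σ|k' - k∘| = Σ|k - k∘| - 2`) exactly when `gα_η > 0 ∧ ⟨d, (gα_η)^∨⟩ ≤ -1` or `gα_η < 0 ∧ ⟨d, (gα_η)^∨⟩ ≤ -2` («`0 ≥ (w(α₀), d) + 1`»,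
«`0 > (w(α₀), d) + 1`»), and rises (`+ 2`) otherwise. [cite: IwahoriMatsumoto1965, §1.9 Proposition 1.29 (i), (ii)] [cite: Humphreys1990, §4.4 Proposition (c)] -/
theorem sum_abs_data_mul_affineReflection_one_eq [Nonempty ι] [DecidablePred b.IsPos] {η : ι}
    (hη : ∀ k, P.coroot η - P.coroot k ∈ AddSubmonoid.closure (P.coroot '' (b.support : Set ι))) {d : M} (hd : d ∈ weightLattice P)
    {m : ι → ℤ} (hm : ∀ i, P.coroot' i d = m i) {g : P.Aut} (hg : g ∈ P.weylGroup) {k k' : ι → ℤ}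
    (hk : (AffineEquiv.constVAdd K M d * affineHom P g) '' {x : M | ∀ i, b.IsPos i → 0 < P.coroot' i x ∧ P.coroot' i x < 1} = alcove P k)
    (hk' : ⇑(AffineEquiv.constVAdd K M d * affineHom P g * affineReflection P η 1) ''
      {x : M | ∀ i, b.IsPos i → 0 < P.coroot' i x ∧ P.coroot' i x < 1} = alcove P k') :
    (((b.IsPos (g • η) ∧ m (g • η) ≤ -1) ∨ (¬ b.IsPos (g • η) ∧ m (g • η) ≤ -2)) →
      ∑ i, |k' i - (if b.IsPos i then (0 : ℤ) else -1)| = ∑ i, |k i - (if b.IsPos i then (0 : ℤ) else -1)| - 2) ∧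
    (¬ ((b.IsPos (g • η) ∧ m (g • η) ≤ -1) ∨ (¬ b.IsPos (g • η) ∧ m (g • η) ≤ -2)) →
      ∑ i, |k' i - (if b.IsPos i then (0 : ℤ) else -1)| = ∑ i, |k i - (if b.IsPos i then (0 : ℤ) else -1)| + 2) := by
  have hσ : AffineEquiv.constVAdd K M d * affineHom P g ∈ extendedAffineWeylGroup P :=
    Subgroup.mul_mem _ (constVAdd_mem_extendedAffineWeylGroup P hd) (affineHom_mem_extendedAffineWeylGroup P hg)
  have hk'' : ⇑(AffineEquiv.constVAdd K M d * affineHom P g * affineReflection P η ((1 : ℤ) : K)) ''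
      {x : M | ∀ i, b.IsPos i → 0 < P.coroot' i x ∧ P.coroot' i x < 1} = alcove P k' := by
    rw [Int.cast_one]; exact hk'
  have hq := image_inv_constVAdd_mul_affineHom_fundamentalAlcove b hm g
  obtain ⟨h1, h2⟩ := sum_abs_data_mul_wall_eq b hη hσ (a := η) (ma := 1) (Or.inr ⟨rfl, rfl⟩) hk hk'' hq
  have hηpos : b.IsPos η := (flip_isPos_iff b η).mp (isPos_of_highestRoot (P := P.flip) b.flip (θ := η)
    (by simpa only [RootPairing.flip_root, RootPairing.Base.flip_support] using hη))
  have hiff : Xor ((1 : ℤ) ≤ (if b.IsPos η then (0 : ℤ) else -1)) ((1 : ℤ) ≤ (if b.IsPos (g • η) then (0 : ℤ) else -1) + -m (g • η)) ↔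
      ((b.IsPos (g • η) ∧ m (g • η) ≤ -1) ∨ (¬ b.IsPos (g • η) ∧ m (g • η) ≤ -2)) := by
    rw [if_pos hηpos]
    by_cases hgη : b.IsPos (g • η)
    · rw [if_pos hgη]; unfold Xor; constructor
      · rintro (⟨h, -⟩ | ⟨h, -⟩)
        · exact absurd h (by norm_num)
        · exact Or.inl ⟨hgη, by omega⟩
      · rintro (⟨-, h⟩ | ⟨h, -⟩)
        · exact Or.inr ⟨by omega, by norm_num⟩
        · exact absurd hgη h
    · rw [if_neg hgη]; unfold Xor; constructor
      · rintro (⟨h, -⟩ | ⟨h, -⟩)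
        · exact absurd h (by norm_num)
        · exact Or.inr ⟨hgη, by omega⟩
      · rintro (⟨h, -⟩ | ⟨-, h⟩)
        · exact absurd h hgη
        · exact Or.inr ⟨by omega, by norm_num⟩
  exact ⟨fun h ↦ h1 (hiff.mpr h), fun h ↦ h2 (fun h' ↦ h (hiff.mp h'))⟩

end FloorData

/-! ## §3 The word length on `W_a` -/

section Length

/-- ★★★ **PROPOSITION 1.28 FOR THE COXETER LENGTH ON `W_a`**: for `σ = t(d)g` (`d ∈ Q` with levels `m`, `g ∈ W`) and `j ∈ Δ`,
`ℓ(σ s_{α_j}) = ℓ(σ) - 1` if `gα_j > 0 ∧ ⟨d, (gα_j)^∨⟩ > 0` or `gα_j < 0 ∧ ⟨d, (gα_j)^∨⟩ ≥ 0`, and `ℓ(σ s_{α_j}) = ℓ(σ) + 1` otherwise.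
[cite: IwahoriMatsumoto1965, §1.9 Proposition 1.28 and §1.5 Proposition 1.10 (λ = l)] [cite: Humphreys1990, §4.4 Proposition (c), §4.5 Theorem (b)] -/
theorem length_mul_wallReflection_some_eq [Nonempty ι] [DecidablePred b.IsPos] {η : ι}
    (hη : ∀ k, P.coroot η - P.coroot k ∈ AddSubmonoid.closure (P.coroot '' (b.support : Set ι))) {d : M} (hd : d ∈ P.rootSpan ℤ)
    {m : ι → ℤ} (hm : ∀ i, P.coroot' i d = m i) {g : P.Aut} (hg : g ∈ P.weylGroup) (j : b.support) :
    (((b.IsPos (g • (j : ι)) ∧ 0 < m (g • (j : ι))) ∨ (¬ b.IsPos (g • (j : ι)) ∧ 0 ≤ m (g • (j : ι)))) →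
      PreCoxeterSystem.length (wallReflection b η)
          (⟨AffineEquiv.constVAdd K M d * affineHom P g,
            Subgroup.mul_mem _ (constVAdd_mem_affineWeylGroup_of_mem_rootSpan P hd) (affineHom_mem_affineWeylGroup P hg)⟩ *
            wallReflection b η (some j)) + 1 =
        PreCoxeterSystem.length (wallReflection b η)
          ⟨AffineEquiv.constVAdd K M d * affineHom P g,
            Subgroup.mul_mem _ (constVAdd_mem_affineWeylGroup_of_mem_rootSpan P hd) (affineHom_mem_affineWeylGroup P hg)⟩) ∧
    (¬ ((b.IsPos (g • (j : ι)) ∧ 0 < m (g • (j : ι))) ∨ (¬ b.IsPos (g • (j : ι)) ∧ 0 ≤ m (g • (j : ι)))) →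
      PreCoxeterSystem.length (wallReflection b η)
          (⟨AffineEquiv.constVAdd K M d * affineHom P g,
            Subgroup.mul_mem _ (constVAdd_mem_affineWeylGroup_of_mem_rootSpan P hd) (affineHom_mem_affineWeylGroup P hg)⟩ *
            wallReflection b η (some j)) =
        PreCoxeterSystem.length (wallReflection b η)
          ⟨AffineEquiv.constVAdd K M d * affineHom P g,
            Subgroup.mul_mem _ (constVAdd_mem_affineWeylGroup_of_mem_rootSpan P hd) (affineHom_mem_affineWeylGroup P hg)⟩ + 1) := by
  set σ : affineWeylGroup P := ⟨AffineEquiv.constVAdd K M d * affineHom P g,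
    Subgroup.mul_mem _ (constVAdd_mem_affineWeylGroup_of_mem_rootSpan P hd) (affineHom_mem_affineWeylGroup P hg)⟩ with hσ
  have hdP : d ∈ weightLattice P := rootSpan_le_weightLattice P ((Submodule.mem_toAddSubgroup _).mpr hd)
  obtain ⟨k, hk, hlen⟩ := exists_two_mul_length_affineWeylGroup_eq b hη σ
  obtain ⟨k', hk', hlen'⟩ := exists_two_mul_length_affineWeylGroup_eq b hη (σ * wallReflection b η (some j))
  have hk'c : ⇑(AffineEquiv.constVAdd K M d * affineHom P g * affineHom P (RootPairing.Equiv.reflection P j)) ''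
      {x : M | ∀ i, b.IsPos i → 0 < P.coroot' i x ∧ P.coroot' i x < 1} = alcove P k' := hk'
  obtain ⟨h1, h2⟩ := sum_abs_data_mul_reflection_eq b hη hdP hm hg j.2 hk hk'c
  constructor
  · intro h
    have := h1 h
    rw [← hlen, ← hlen'] at this
    omega
  · intro h
    have := h2 h
    rw [← hlen, ← hlen'] at this
    omega

/-- ★★★ **PROPOSITION 1.29 FOR THE COXETER LENGTH ON `W_a`**: for `σ = t(d)g` (`d ∈ Q`, `g ∈ W`) and the new wall,
`ℓ(σ s_{α_η,1}) = ℓ(σ) - 1` if `gα_η > 0 ∧ ⟨d, (gα_η)^∨⟩ ≤ -1` or `gα_η < 0 ∧ ⟨d, (gα_η)^∨⟩ ≤ -2`, and `ℓ(σ s_{α_η,1}) = ℓ(σ) + 1` otherwise.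
[cite: IwahoriMatsumoto1965, §1.9 Proposition 1.29 and §1.5 Proposition 1.10] [cite: Humphreys1990, §4.4 Proposition (c), §4.5 Theorem (b)] -/
theorem length_mul_wallReflection_none_eq [Nonempty ι] [DecidablePred b.IsPos] {η : ι}
    (hη : ∀ k, P.coroot η - P.coroot k ∈ AddSubmonoid.closure (P.coroot '' (b.support : Set ι))) {d : M} (hd : d ∈ P.rootSpan ℤ)
    {m : ι → ℤ} (hm : ∀ i, P.coroot' i d = m i) {g : P.Aut} (hg : g ∈ P.weylGroup) :
    (((b.IsPos (g • η) ∧ m (g • η) ≤ -1) ∨ (¬ b.IsPos (g • η) ∧ m (g • η) ≤ -2)) →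
      PreCoxeterSystem.length (wallReflection b η)
          (⟨AffineEquiv.constVAdd K M d * affineHom P g,
            Subgroup.mul_mem _ (constVAdd_mem_affineWeylGroup_of_mem_rootSpan P hd) (affineHom_mem_affineWeylGroup P hg)⟩ *
            wallReflection b η none) + 1 =
        PreCoxeterSystem.length (wallReflection b η)
          ⟨AffineEquiv.constVAdd K M d * affineHom P g,
            Subgroup.mul_mem _ (constVAdd_mem_affineWeylGroup_of_mem_rootSpan P hd) (affineHom_mem_affineWeylGroup P hg)⟩) ∧
    (¬ ((b.IsPos (g • η) ∧ m (g • η) ≤ -1) ∨ (¬ b.IsPos (g • η) ∧ m (g • η) ≤ -2)) →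
      PreCoxeterSystem.length (wallReflection b η)
          (⟨AffineEquiv.constVAdd K M d * affineHom P g,
            Subgroup.mul_mem _ (constVAdd_mem_affineWeylGroup_of_mem_rootSpan P hd) (affineHom_mem_affineWeylGroup P hg)⟩ *
            wallReflection b η none) =
        PreCoxeterSystem.length (wallReflection b η)
          ⟨AffineEquiv.constVAdd K M d * affineHom P g,
            Subgroup.mul_mem _ (constVAdd_mem_affineWeylGroup_of_mem_rootSpan P hd) (affineHom_mem_affineWeylGroup P hg)⟩ + 1) := by
  set σ : affineWeylGroup P := ⟨AffineEquiv.constVAdd K M d * affineHom P g,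
    Subgroup.mul_mem _ (constVAdd_mem_affineWeylGroup_of_mem_rootSpan P hd) (affineHom_mem_affineWeylGroup P hg)⟩ with hσ
  have hdP : d ∈ weightLattice P := rootSpan_le_weightLattice P ((Submodule.mem_toAddSubgroup _).mpr hd)
  obtain ⟨k, hk, hlen⟩ := exists_two_mul_length_affineWeylGroup_eq b hη σ
  obtain ⟨k', hk', hlen'⟩ := exists_two_mul_length_affineWeylGroup_eq b hη (σ * wallReflection b η none)
  have hk'c : ⇑(AffineEquiv.constVAdd K M d * affineHom P g * affineReflection P η 1) ''
      {x : M | ∀ i, b.IsPos i → 0 < P.coroot' i x ∧ P.coroot' i x < 1} = alcove P k' := hk'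
  obtain ⟨h1, h2⟩ := sum_abs_data_mul_affineReflection_one_eq b hη hdP hm hg hk hk'c
  constructor
  · intro h
    have := h1 h
    rw [← hlen, ← hlen'] at this
    omega
  · intro h
    have := h2 h
    rw [← hlen, ← hlen'] at this
    omega

/-- ★★ **`d = 0`: DESCENTS OF A FINITE WEYL GROUP ELEMENT IN `W_a`** — for `g ∈ W` and `j ∈ Δ`, `ℓ(g s_{α_j}) = ℓ(g) - 1 ⟺ gα_j < 0` (else
`ℓ(g) + 1`), and the new wall is NEVER a descent: `ℓ(g s_{α_η,1}) = ℓ(g) + 1`. [cite: IwahoriMatsumoto1965, §1.9 Propositions 1.28, 1.29 (d = 0)] [cite: Humphreys1990, §1.6 Lemma and §4.4 Proposition (c)] -/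
theorem length_affineHom_mul_wallReflection_eq [Nonempty ι] [DecidablePred b.IsPos] {η : ι}
    (hη : ∀ k, P.coroot η - P.coroot k ∈ AddSubmonoid.closure (P.coroot '' (b.support : Set ι))) {g : P.Aut} (hg : g ∈ P.weylGroup)
    (j : b.support) :
    (¬ b.IsPos (g • (j : ι)) →
      PreCoxeterSystem.length (wallReflection b η) (⟨affineHom P g, affineHom_mem_affineWeylGroup P hg⟩ * wallReflection b η (some j)) + 1 =
        PreCoxeterSystem.length (wallReflection b η) ⟨affineHom P g, affineHom_mem_affineWeylGroup P hg⟩) ∧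
    (b.IsPos (g • (j : ι)) →
      PreCoxeterSystem.length (wallReflection b η) (⟨affineHom P g, affineHom_mem_affineWeylGroup P hg⟩ * wallReflection b η (some j)) =
        PreCoxeterSystem.length (wallReflection b η) ⟨affineHom P g, affineHom_mem_affineWeylGroup P hg⟩ + 1) ∧
    PreCoxeterSystem.length (wallReflection b η) (⟨affineHom P g, affineHom_mem_affineWeylGroup P hg⟩ * wallReflection b η none) =
        PreCoxeterSystem.length (wallReflection b η) ⟨affineHom P g, affineHom_mem_affineWeylGroup P hg⟩ + 1 := by
  have hm : ∀ i, P.coroot' i (0 : M) = ((0 : ℤ) : K) := fun i ↦ by rw [map_zero, Int.cast_zero]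
  have he : (⟨AffineEquiv.constVAdd K M 0 * affineHom P g,
      Subgroup.mul_mem _ (constVAdd_mem_affineWeylGroup_of_mem_rootSpan P (Submodule.zero_mem _)) (affineHom_mem_affineWeylGroup P hg)⟩ :
        affineWeylGroup P) = ⟨affineHom P g, affineHom_mem_affineWeylGroup P hg⟩ := by
    apply Subtype.ext
    show AffineEquiv.constVAdd K M 0 * affineHom P g = affineHom P g
    rw [mul_eq_right]
    exact AffineEquiv.ext fun x ↦ by simp
  obtain ⟨h1, h2⟩ := length_mul_wallReflection_some_eq b hη (Submodule.zero_mem _) hm hg j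
  obtain ⟨-, h4⟩ := length_mul_wallReflection_none_eq b hη (Submodule.zero_mem _) hm hg
  rw [he] at h1 h2 h4
  refine ⟨fun h ↦ h1 (Or.inr ⟨h, le_rfl⟩), fun h ↦ h2 ?_, h4 ?_⟩
  · rintro (⟨-, h'⟩ | ⟨h', -⟩)
    · exact lt_irrefl _ h'
    · exact h' h
  · rintro (⟨-, h'⟩ | ⟨-, h'⟩) <;> omega

/-- ★★ **`g = 1`: DESCENTS OF A TRANSLATION** — for `d ∈ Q` with levels `m` and `j ∈ Δ`: `ℓ(t(d) s_{α_j}) = ℓ(t(d)) - 1 ⟺ ⟨d, α_j^∨⟩ > 0`, and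
`ℓ(t(d) s_{α_η,1}) = ℓ(t(d)) - 1 ⟺ ⟨d, α_η^∨⟩ ≤ -1`. [cite: IwahoriMatsumoto1965, §1.9 Propositions 1.28, 1.29 (w = 1)] [cite: Humphreys1990, §4.4 Proposition (c)] -/
theorem length_constVAdd_mul_wallReflection_eq [Nonempty ι] [DecidablePred b.IsPos] {η : ι}
    (hη : ∀ k, P.coroot η - P.coroot k ∈ AddSubmonoid.closure (P.coroot '' (b.support : Set ι))) {d : M} (hd : d ∈ P.rootSpan ℤ)
    {m : ι → ℤ} (hm : ∀ i, P.coroot' i d = m i) (j : b.support) :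
    ((0 < m j →
      PreCoxeterSystem.length (wallReflection b η)
          (⟨AffineEquiv.constVAdd K M d, constVAdd_mem_affineWeylGroup_of_mem_rootSpan P hd⟩ * wallReflection b η (some j)) + 1 =
        PreCoxeterSystem.length (wallReflection b η) ⟨AffineEquiv.constVAdd K M d, constVAdd_mem_affineWeylGroup_of_mem_rootSpan P hd⟩) ∧
    (m j ≤ 0 →
      PreCoxeterSystem.length (wallReflection b η)
          (⟨AffineEquiv.constVAdd K M d, constVAdd_mem_affineWeylGroup_of_mem_rootSpan P hd⟩ * wallReflection b η (some j)) =
        PreCoxeterSystem.length (wallReflection b η) ⟨AffineEquiv.constVAdd K M d, constVAdd_mem_affineWeylGroup_of_mem_rootSpan P hd⟩ + 1)) ∧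
    ((m η ≤ -1 →
      PreCoxeterSystem.length (wallReflection b η)
          (⟨AffineEquiv.constVAdd K M d, constVAdd_mem_affineWeylGroup_of_mem_rootSpan P hd⟩ * wallReflection b η none) + 1 =
        PreCoxeterSystem.length (wallReflection b η) ⟨AffineEquiv.constVAdd K M d, constVAdd_mem_affineWeylGroup_of_mem_rootSpan P hd⟩) ∧
    (0 ≤ m η →
      PreCoxeterSystem.length (wallReflection b η)
          (⟨AffineEquiv.constVAdd K M d, constVAdd_mem_affineWeylGroup_of_mem_rootSpan P hd⟩ * wallReflection b η none) =
        PreCoxeterSystem.length (wallReflection b η) ⟨AffineEquiv.constVAdd K M d, constVAdd_mem_affineWeylGroup_of_mem_rootSpan P hd⟩ + 1)) := by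
  have he : (⟨AffineEquiv.constVAdd K M d * affineHom P 1,
      Subgroup.mul_mem _ (constVAdd_mem_affineWeylGroup_of_mem_rootSpan P hd) (affineHom_mem_affineWeylGroup P (Subgroup.one_mem _))⟩ :
        affineWeylGroup P) = ⟨AffineEquiv.constVAdd K M d, constVAdd_mem_affineWeylGroup_of_mem_rootSpan P hd⟩ := by
    apply Subtype.ext
    show AffineEquiv.constVAdd K M d * affineHom P 1 = AffineEquiv.constVAdd K M d
    rw [map_one, mul_one]
  have hjpos : b.IsPos (j : ι) := b.isPos_of_mem_support j.2
  have hηpos : b.IsPos η := (flip_isPos_iff b η).mp (isPos_of_highestRoot (P := P.flip) b.flip (θ := η)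
    (by simpa only [RootPairing.flip_root, RootPairing.Base.flip_support] using hη))
  obtain ⟨h1, h2⟩ := length_mul_wallReflection_some_eq b hη hd hm (Subgroup.one_mem _) j
  obtain ⟨h3, h4⟩ := length_mul_wallReflection_none_eq b hη hd hm (Subgroup.one_mem _)
  rw [he] at h1 h2 h3 h4
  simp only [one_smul] at h1 h2 h3 h4
  refine ⟨⟨fun h ↦ h1 (Or.inl ⟨hjpos, h⟩), fun h ↦ h2 ?_⟩, ⟨fun h ↦ h3 (Or.inl ⟨hηpos, h⟩), fun h ↦ h4 ?_⟩⟩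
  · rintro (⟨-, h'⟩ | ⟨h', -⟩)
    · omega
    · exact h' hjpos
  · rintro (⟨-, h'⟩ | ⟨h', -⟩)
    · omega
    · exact h' hηpos

end Length

end Base

end Literature.LinearAlgebra.RootSystem
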